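import Mathlib
import Summits.Ventures.PercRepro2.OneTypedEdge
import Summits.Ventures.PercRepro2.TypedUntouched
import Summits.Ventures.PercRepro2.TypedSwapRoots

/-!
# Two copies carrying `b` and `a₃` in the cluster of a root kill every typed base; the coincident
mark `b = a₃` with a type-2 root edge (blind cell PercRepro2, night-3 g14, 2026-08-27;
`proofs/NIGHT3-CERT.md` §23)

**State level** (`KBsym_eq_zero_of_two_Lb3`, 8,192 cases): the `S₃`-symmetrised kernel vanishes on
every state triple in which two of the three states have `b ∈ C(a₁)` and `a₃ ∈ C(a₁)` (and, as `Q`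
holds there, `b, a₃ ∉ C(a₂)`); the third state is arbitrary.  Mechanism: with `a₃ ∈ C(a₁)` the two
copies fail `PD`, so of the eight terms of `K₃` only the second and the fifth survive under the
permutations, and with `σ_b = σ₃ = 1` in those copies they cancel pairwise
(`q(x) pd(c) u_o(c) q(w) σ₃ σ_b (w)` against `− pd(c) u_o(c) q(y) σ_b(y) q(w) σ₃(w)`).

**Graph level**: for the COINCIDENT marking `b = a₃` a typed root edge `e = {a₁, a₃}` of type `2` is
open in two copies, which then carry `b = a₃ ∈ C(a₁)`; hence every typed base vanishes
(`typedCount_eq_zero_of_coinc_root_edge_two`, every graph, pinning and typing of the other edges;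
the mirror at `a₂` is `typedCount_eq_zero_of_coinc_root_edge_two'`).  The type-1 case is live
(2,984 / 25,536 nonzero typed bases in the random census of `mining/night-3/g14/census_r8.py`);
the rule is the first of the coincident-mark rules behind the identically-vanishing instances of
the ∣F∣ = 9 domain of record with `b = a₃`.  Nothing here asserts anything about the original lane.
-/

namespace Summit.Ventures.PercRepro2

open UnionCluster

namespace CovForm

namespace CoincRoot

open OneTyped Untouched

/-! ## The state-level identity -/

section States

/-- **The symmetrised kernel vanishes when two states carry `b` and `a₃` in `C(a₁)`** (8,192
cases; the third state is arbitrary). -/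
theorem KBsym_eq_zero_of_two_Lb3 (x : St) (q Lo Ho q' Lo' Ho' : Bool) :
    KBsym x (mkSt q Lo true true Ho false false) (mkSt q' Lo' true true Ho' false false) = 0 := by
  revert x q Lo Ho q' Lo' Ho'
  decide +kernel

/-- The symmetrised kernel vanishes as soon as one state fails `Q`. -/
theorem KBsym_eq_zero_of_q' (x y z : St) (h : x.q' = true ∨ y.q' = true ∨ z.q' = true) :
    KBsym x y z = 0 := by
  unfold KBsym
  rcases h with h | h | h
  · rw [KB_eq_zero_of_q' x y z (Or.inl h), KB_eq_zero_of_q' x z y (Or.inl h),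
      KB_eq_zero_of_q' y x z (Or.inr (Or.inl h)), KB_eq_zero_of_q' y z x (Or.inr (Or.inr h)),
      KB_eq_zero_of_q' z x y (Or.inr (Or.inl h)), KB_eq_zero_of_q' z y x (Or.inr (Or.inr h))]
    ring
  · rw [KB_eq_zero_of_q' x y z (Or.inr (Or.inl h)), KB_eq_zero_of_q' x z y (Or.inr (Or.inr h)),
      KB_eq_zero_of_q' y x z (Or.inl h), KB_eq_zero_of_q' y z x (Or.inl h),
      KB_eq_zero_of_q' z x y (Or.inr (Or.inr h)), KB_eq_zero_of_q' z y x (Or.inr (Or.inl h))]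
    ring
  · rw [KB_eq_zero_of_q' x y z (Or.inr (Or.inr h)), KB_eq_zero_of_q' x z y (Or.inr (Or.inl h)),
      KB_eq_zero_of_q' y x z (Or.inr (Or.inr h)), KB_eq_zero_of_q' y z x (Or.inr (Or.inl h)),
      KB_eq_zero_of_q' z x y (Or.inl h), KB_eq_zero_of_q' z y x (Or.inl h)]
    ring

/-- The symmetrised kernel is symmetric in its arguments. -/
theorem KBsym_comm_left (x y z : St) : KBsym x y z = KBsym y x z := by
  unfold KBsym; ring

/-- The symmetrised kernel is symmetric in its arguments. -/
theorem KBsym_comm_right (x y z : St) : KBsym x y z = KBsym x z y := by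
  unfold KBsym; ring

end States

/-! ## The graph level -/

section Main

open Classical

variable {V : Type*} {E : Type*} [Fintype E] [DecidableEq E] {R : Type*} [Field R]
  [LinearOrder R] [IsStrictOrderedRing R]
variable (ends : E → Sym2 V) (o a₁ a₂ a₃ : V)

omit [Fintype E] [DecidableEq E] [LinearOrder R] [IsStrictOrderedRing R] in
/-- For the coincident marking `b = a₃`, a configuration with `a₃ ∈ C(a₁)` either fails `Q` or has
the state `mkSt false L_o true true H_o false false`. -/
lemma st_coinc_of_conn_a1_a3 (u : Config E) (h : Conn ends u a₁ a₃) :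
    (st ends o a₁ a₂ a₃ a₃ u).q' = true ∨
      st ends o a₁ a₂ a₃ a₃ u =
        mkSt false (decide (Conn ends u a₁ o)) true true (decide (Conn ends u a₂ o)) false false := by
  by_cases hq : Conn ends u a₂ a₁
  · left
    unfold st St.q'
    exact decide_eq_true hq
  · right
    have h3 : ¬ Conn ends u a₂ a₃ := fun h' => hq (conn_trans h' (conn_symm h))
    unfold st mkSt
    simp only [h, h3, decide_true, decide_false, hq]

omit [Fintype E] [DecidableEq E] in
/-- Three Booleans summing to two: two of them are `true`. -/
lemma two_of_three {x y w : Config E} {e : E}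
    (h : (x e).toNat + (y e).toNat + (w e).toNat = 2) :
    (x e = true ∧ y e = true) ∨ (x e = true ∧ w e = true) ∨ (y e = true ∧ w e = true) := by
  cases hx : x e <;> cases hy : y e <;> cases hw : w e <;> simp_all

omit [Fintype E] [DecidableEq E] [LinearOrder R] [IsStrictOrderedRing R] in
/-- **The symmetrised kernel vanishes on a triple two of whose copies carry `a₃ ∈ C(a₁)`**, for
the coincident marking `b = a₃`. -/
lemma KBsym_st_eq_zero_of_two (t u v : Config E) (hu : Conn ends u a₁ a₃) (hv : Conn ends v a₁ a₃) :
    KBsym (st ends o a₁ a₂ a₃ a₃ t) (st ends o a₁ a₂ a₃ a₃ u) (st ends o a₁ a₂ a₃ a₃ v) = 0 := by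
  rcases st_coinc_of_conn_a1_a3 ends o a₁ a₂ a₃ u hu with hqu | hsu
  · exact KBsym_eq_zero_of_q' _ _ _ (Or.inr (Or.inl hqu))
  rcases st_coinc_of_conn_a1_a3 ends o a₁ a₂ a₃ v hv with hqv | hsv
  · exact KBsym_eq_zero_of_q' _ _ _ (Or.inr (Or.inr hqv))
  rw [hsu, hsv]
  exact KBsym_eq_zero_of_two_Lb3 _ _ _ _ _ _ _

/-- **The coincident marking `b = a₃` with a root edge of type 2: every typed base vanishes**
(every graph, every pinning and typing of the other edges with types in `{1, 2}`). -/
theorem typedCount_eq_zero_of_coinc_root_edge_two {e : E} (he : ends e = s(a₁, a₃)) (F : Finset E)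
    (heF : e ∈ F) (z : Config E) (τ : E → ℕ) (hτ : ∀ e ∈ F, τ e = 1 ∨ τ e = 2) (hτe : τ e = 2) :
    typedCount F z τ (K3 ends o a₁ a₂ a₃ a₃ : Config E → Config E → Config E → R) = 0 := by
  have h6 := six_mul_typedCount F z τ hτ (K3 ends o a₁ a₂ a₃ a₃ : Config E → Config E → Config E → R)
  have hzero : typedCount F z τ (fun x y w : Config E =>
      (K3 ends o a₁ a₂ a₃ a₃ x y w : R) + K3 ends o a₁ a₂ a₃ a₃ x w y + K3 ends o a₁ a₂ a₃ a₃ y x w +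
        K3 ends o a₁ a₂ a₃ a₃ y w x + K3 ends o a₁ a₂ a₃ a₃ w x y + K3 ends o a₁ a₂ a₃ a₃ w y x) =
      typedCount F z τ (fun _ _ _ => (0 : R)) := by
    refine typedCount_congr_on_support F z τ fun x y w _ hτ' => ?_
    have h2 := hτ' e heF
    rw [hτe] at h2
    have key : KBsym (st ends o a₁ a₂ a₃ a₃ x) (st ends o a₁ a₂ a₃ a₃ y) (st ends o a₁ a₂ a₃ a₃ w) = 0 := by
      have conn : ∀ u : Config E, u e = true → Conn ends u a₁ a₃ := fun u hu =>
        conn_of_openAdj ⟨e, hu, he⟩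
      rcases two_of_three h2 with ⟨hx, hy⟩ | ⟨hx, hw⟩ | ⟨hy, hw⟩
      · rw [KBsym_comm_right, KBsym_comm_left]
        exact KBsym_st_eq_zero_of_two ends o a₁ a₂ a₃ w x y (conn x hx) (conn y hy)
      · rw [KBsym_comm_left]
        exact KBsym_st_eq_zero_of_two ends o a₁ a₂ a₃ y x w (conn x hx) (conn w hw)
      · exact KBsym_st_eq_zero_of_two ends o a₁ a₂ a₃ x y w (conn y hy) (conn w hw)
    simp only [K3_eq_KB ends o a₁ a₂ a₃ a₃]
    unfold KBsym at key
    exact_mod_cast key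
  rw [hzero, typedCount_zero_kernel] at h6
  have h6' : (6 : R) ≠ 0 := by norm_num
  exact (mul_eq_zero.mp h6).resolve_left h6'

/-- The mirror: the coincident marking `b = a₃` with a type-2 edge `{a₂, a₃}`. -/
theorem typedCount_eq_zero_of_coinc_root_edge_two' {e : E} (he : ends e = s(a₂, a₃)) (F : Finset E)
    (heF : e ∈ F) (z : Config E) (τ : E → ℕ) (hτ : ∀ e ∈ F, τ e = 1 ∨ τ e = 2) (hτe : τ e = 2) :
    typedCount F z τ (K3 ends o a₁ a₂ a₃ a₃ : Config E → Config E → Config E → R) = 0 := by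
  rw [← SwapRoots.typedCount_swap_roots ends o a₁ a₂ a₃ a₃ F z τ]
  exact typedCount_eq_zero_of_coinc_root_edge_two ends o a₂ a₁ a₃ he F heF z τ hτ hτe

end Main

end CoincRoot

end CovForm

end Summit.Ventures.PercRepro2
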